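import Summits.BirchSwinnertonDyer.BirchSwinnertonDyer.Theorems.ManinLocalTwoThreeManinPrimeToAdditiveFiveLeThirteenDichotomyNoDD
import Summits.BirchSwinnertonDyer.BirchSwinnertonDyer.Theorems.ManinLocalTwoThreeManinPrimeToAdditiveFiveLeLedgerFivePrints
import HarnessLib

/-!
# Route `ManinLocalTwoThree`, residual crux C5 `ManinPrimeToAdditiveFiveLe` (stmt-BirchSwinnertonDyer-22969), line `upper_anchor`
# (skeleton v15): **DOKCHITSER–DOKCHITSER 2015 LEAVES THE CONE** — the `13`-core re-keyed on the rigidity THEOREM, and the single-book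
# ledger of C5 BY NAME ⟸ FOUR cite-only prints {Kato F″, Edixhoven Thm. 3 (Kodaira half, ordinarity half), Mazur's `j`-list} ∧ the seven leaves
# {K15a 27072, K15b 27071, I9 27660, K18a″ 27661, K18b″ 27662, C1 25939, C2 26929} of route `TwistFamilyManinDescent`

Width seat bsd-line-ml23-c5-p1-w2 (gen 6), piece ω3. THEOREMS ONLY (no definition, no named fact, no `sorry`).

The registered skeleton v15 (sha16 d820c51ba6b14c77) has `stub_printedInputs` = F″ ∧ EdK ∧ EdG ∧ MazurJ ∧ D–D and composes through the lead's
`maninPrimeToAdditiveFiveLe_of_fivePrints_of_sevenLeaves` (p637045). Its fifth conjunct, the cite-only named fact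
`dokchitser_padicValInt_minimalDiscriminantInt_eq_of_isogeny_of_potentiallyGoodOrdinary`, is used ONCE on the whole path: inside pub/bsd-wall's
`13`-core (`EisensteinTrichotomy.index_dichotomy_of_strongIsTop` → `not_dvd_c_of_notBottom_of_strongIsTop` → `not_dvd_c_large`), on a (G)-ordinary
additive pair `V ∼ W₀` at `p = 13`. That instance is the tree THEOREM `padicValInt_minimalDiscriminantInt_eq_of_isIsogenous_of_typeGOrd` (piece ω1,
`…IsogenyMinimalDiscriminantRigidity.lean`: Coates' congruence + cyclic prime-step factorisation + the discharged clause `l ≠ p`). This file threads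
it through:

* `EisensteinTrichotomy.not_dvd_c_of_notBottom_of_strongIsTop_noDD`, `EisensteinTrichotomy.not_dvd_c_large_noDD` — the core and the large-prime
  branch of bsd-line-ttd-p1's `TwistFamilyManinDescentEisensteinResidualOfTrichotomy.lean`, statements VERBATIM minus the binder `hDD`, proofs adapted
  verbatim (attribution: that seat's g6 file), fed by piece ω2's `index_dichotomy_of_strongIsTop_noDD`;
* `reducibleTwistMinimal_of_threePrints_of_items`, `maninPrimeToAdditiveFiveLe_of_fourPrints_of_items`,
  **`maninPrimeToAdditiveFiveLe_of_fourPrints_of_sevenLeaves : F″ → EdK → EdG → MazurJ → K15a → K15b → I9 → K18a″ → K18b″ → C1 → C2 → C5 BY NAME`** —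
  the lead's ledger (p637045) minus `hDD`, proofs adapted verbatim. The LEAD's v16 recipe: `stub_printedInputs := F″ ∧ EdK ∧ EdG ∧ MazurJ`
  (4 conjuncts), the six by-name stubs of v15 verbatim, composition := `maninPrimeToAdditiveFiveLe_of_fourPrints_of_sevenLeaves P.1 P.2.1 P.2.2.1
  P.2.2.2 stub_strongIsUnstarred57 stub_ss57 stub_ordinaryCornerLeaves.1 stub_ordinaryCornerLeaves.2.1 stub_ordinaryCornerLeaves.2.2 stub_notBottom13
  stub_strongIsTop13`.

HONEST STATUS (`--supports 22969`, helper): the four prints are cite-only `def … : Prop` (F″ referee-flagged), the seven leaves OPEN items. Nothing here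
proves any leaf, C5, Manin's conjecture or BSD; the gain is one printed liability fewer (Dokchitser–Dokchitser 2015 Thm. 5.1 (1), whose tree fact file
says «WHY NOT A THEOREM YET») on C5's path of record.

References: [Kato2004Asterisque] (8.1.3), Thm. 9.7; [EdixhovenManin1991] Thm. 3, §4; [Mazur1978] Thm. 1; [DokchitserDokchitser2015LocalInvariants]
Thm. 5.1 (1), Cor. 8 (now a tree theorem at `p ≥ 5` on the (G)-locus); [Stevens1989] §2, Lemma (5.4).
-/

set_option autoImplicit false
-- the Theorems namespace of this sub repeats the summit name by design (D-0017 nested layout)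
set_option linter.dupNamespace false

noncomputable section

open scoped Classical NumberField

open WeierstrassCurve IsDedekindDomain Rat.HeightOneSpectrum NumberField
  Literature.NumberTheory.EllipticCurves Literature.NumberTheory.EllipticCurves.ModularForms
  Literature.NumberTheory.EllipticCurves.Rank1Residual
  Summit.BirchSwinnertonDyer.Rank1Residual Summit.BirchSwinnertonDyer.Rank1Residual.Additive
  Summit.BirchSwinnertonDyer.Rank1Residual.ManinAdditive
  Summit.BirchSwinnertonDyer.BirchSwinnertonDyer.Theorems.TeichmullerTwistDescentStarInvolution
  Summit.BirchSwinnertonDyer.BirchSwinnertonDyer.Theses.TwistFamilyManinDescent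

namespace Summit.BirchSwinnertonDyer.BirchSwinnertonDyer.Theorems.TwistFamilyManinDescent.EisensteinTrichotomy

open TeichmullerTwistDescent.TwistedPeriodLatticeIndexFrame

/-! ### §1 The `13`-core and the large-prime branch without `hDD` (adapted verbatim from bsd-line-ttd-p1) -/

/-- **The core of LINE 12, GRANTED C1, C2, Edixhoven's Kodaira form and modularity — rigidity is now the tree THEOREM
`padicValInt_minimalDiscriminantInt_eq_of_isIsogenous_of_typeGOrd` (no `hDD`).** For
`W/ℚ` globally minimal with a LATTICE-OPTIMAL conductor-level datum `D` (`W` is the `X₀(N)`-optimal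
curve, `c = c(D)` its Manin constant), `p = 13` with `p² ∣ N`, `W[p]` REDUCIBLE, `W` (G)-ordinary at `p`
and UNSTARRED (`ord_p Δ_min ≤ 4`): `p ∤ c(D)`. By `index_dichotomy_of_strongIsTop` the twisted lattice is
TOP or BOTTOM; BOTTOM contradicts C1 at `W`; TOP gives `qΛ_{W₀} = Λ_V` (`q = cu/c₀`), so `q = ±1` by the
integrality of Néron scalings, `ord_p c = ord_p c₀`, and `p ∤ c₀` by Edixhoven's Kodaira form at the
STARRED optimal curve `W₀` (`ord_p Δ_min(W₀) = ord_p Δ_min(V) = ord_p Δ_min(W) + 6 ≥ 8`, rigidity).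
[cite: EdixhovenManin1991, Thm. 3 and §4] [cite: Stevens1989, Lemma (5.4) p. 97]
[cite: DokchitserDokchitser2015LocalInvariants, Thm. 5.1 (1)] -/
theorem not_dvd_c_of_notBottom_of_strongIsTop_noDD (hnf : exists_isNewformOf)
    (hC1 : EisensteinOrdinaryTwistLatticeNotBottom) (hC2 : EisensteinOrdinaryStrongIsTop)
    (hEdK : edixhoven_not_dvd_maninConstant_of_kodairaSymbol_ne)
    (W : WeierstrassCurve ℚ) [W.IsElliptic] [W.IsGloballyMinimal] (p : ℕ) [Fact p.Prime]
    [NeZero (W.conductorNorm ℤ)] (D : ModularParametrizationData W (W.conductorNorm ℤ))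
    (hsq : p ^ 2 ∣ W.conductorNorm ℤ) (hp13 : p = 13) (hred : ¬ Rank1Residual.Irr W p)
    (hGo : TypeGOrd W p) (hV4 : padicValInt p W.minimalDiscriminantInt ≤ 4)
    (hopt : ∀ z ∈ D.L.lattice, ∃ w ∈ periodLattice D.f, z = D.c * w) :
    ¬ (p : ℤ) ∣ D.c := by
  have hpP : p.Prime := Fact.out
  have hp11 : 11 ≤ p := by omega
  have hp2 : p ≠ 2 := by omega
  have hp5 : 5 ≤ p := by omega
  have hp7 : 7 < p := by omega
  have hadd : Rank1Residual.Addv W p := not_good_and_not_mult_of_sq_dvd_conductorNorm W hsq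
  have hj : 0 ≤ padicValRat p W.j := padicValRat_j_nonneg_of_typeGOrd W p hGo
  have hW6 : padicValInt p W.minimalDiscriminantInt < 6 := by omega
  -- THE quadratic character mod `p`, its Gauss sum, the twisted newform
  set χ : DirichletCharacter ℂ p := (quadraticChar (ZMod p)).ringHomComp (Int.castRingHom ℂ) with hχdef
  have hχ : χ.IsQuadratic := isQuadratic_quadraticChar_ringHomComp p
  have hprim : χ.IsPrimitive := isPrimitive_quadraticChar_ringHomComp p hp2
  set G : ℂ := gaussSum χ (ZMod.stdAddChar (N := p)) with hGdef
  have hG0 : G ≠ 0 := gaussSum_stdAddChar_ne_zero_of_isPrimitive hprim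
  set fχ := charTwist (W.conductorNorm ℤ) (dvd_refl _) hsq hχ D.f with hfχdef
  have hStevens : ∀ w ∈ periodLattice fχ, G * w ∈ periodLattice D.f := fun w hw ↦
    gaussSum_mul_mem_periodLattice_of_mem_charTwist (W.conductorNorm ℤ) (dvd_refl _) hsq hχ hprim D.f hw
  -- TOP or BOTTOM (C2 + rigidity); BOTTOM contradicts C1
  rcases index_dichotomy_of_strongIsTop_noDD hnf hC2 W p D hsq hp13 hred hGo hV4 hopt χ hχ hprim with
    htop | hbot
  swap
  · exact absurd hbot (hC1 W p D hsq hp11 hadd hred hGo hV4 hopt χ hχ hprim)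
  rw [← hGdef] at htop
  -- the twist frame
  obtain ⟨V, W₀, hVe, hVm, hE₀, hM₀, C, LV, D₀, hC, hu, hAV, hjV, hvV, hLV, hiso, hN₀, hopt₀, hfeq⟩ :=
    exists_twist_frame hnf W p D hsq hp5 hadd hj hW6 hχ
  haveI := hVe
  haveI := hVm
  haveI := hE₀
  haveI := hM₀
  haveI : NeZero (W₀.conductorNorm ℤ) := ⟨(conductorNorm_pos_holds W₀).ne'⟩
  have htw : ∀ x : ℂ, x ∈ LV.lattice ↔ G * ((((C.u : ℚ) : ℂ))⁻¹ * x) ∈ D.L.lattice := fun x ↦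
    mem_lattice_twist_pStar_iff p hp2 W V D.isNeronLattice hLV C hC x
  -- `W₀` is additive, (G)-ordinary and STARRED (rigidity), hence `p ∤ c₀` (Edixhoven, Kodaira form)
  have hGoV : TypeGOrd V p :=
    (typeGOrd_iff_of_star_pair p hp5 V W hAV hadd hjV hj (by omega)).mpr hGo
  have hadd₀ : Rank1Residual.Addv W₀ p := (X2.addv_iff_of_isIsogenous (p := p) hiso).mp hAV
  have hv₀ : padicValInt p W₀.minimalDiscriminantInt = padicValInt p W.minimalDiscriminantInt + 6 := by
    rw [← hvV]
    exact (padicValInt_minimalDiscriminantInt_eq_of_isIsogenous_of_typeGOrd hp5 hiso hAV hGoV).symm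
  have hvW := padicValInt_minimalDiscriminantInt_mem_of_addv_of_padicValRat_j_nonneg W p hp5 hadd hj
  have hc₀ : ¬ (p : ℤ) ∣ D₀.c := by
    obtain ⟨D₀', hopt₀', hc'⟩ := exists_optimalDatum_of_level_eq_c hN₀.symm D₀ hopt₀
    have hnot : ¬ (W₀.kodairaSymbolAt (placeOf p) = .II ∨ W₀.kodairaSymbolAt (placeOf p) = .III ∨
        W₀.kodairaSymbolAt (placeOf p) = .IV) := fun h ↦ by
      have h4 := (kodairaSymbolAt_placeOf_II_or_III_or_IV_iff_of_addv W₀ p hp5 hadd₀).mp h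
      omega
    rw [← hc']
    exact hEdK W₀ D₀' hopt₀' p hpP hp7 (fun h ↦ hnot (Or.inl h)) (fun h ↦ hnot (Or.inr (Or.inl h)))
      (fun h ↦ hnot (Or.inr (Or.inr h)))
  -- constants and the rational multiplier `q = c u / c₀`
  have hc : D.c ≠ 0 := D.maninConstant_ne_zero_holds
  have hc₀0 : D₀.c ≠ 0 := D₀.maninConstant_ne_zero_holds
  have hu0 : (C.u : ℚ) ≠ 0 := C.u.ne_zero
  have hcℂ : (D.c : ℂ) ≠ 0 := by exact_mod_cast hc
  have hc₀ℂ : (D₀.c : ℂ) ≠ 0 := by exact_mod_cast hc₀0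
  have huℂ : (((C.u : ℚ) : ℚ) : ℂ) ≠ 0 := by exact_mod_cast hu0
  set q : ℚ := (D.c : ℚ) * (C.u : ℚ) / (D₀.c : ℚ) with hqdef
  have hq0 : q ≠ 0 := div_ne_zero (mul_ne_zero (by exact_mod_cast hc) hu0) (by exact_mod_cast hc₀0)
  have hqℂ : ((q : ℚ) : ℂ) = (D.c : ℂ) * (((C.u : ℚ) : ℚ) : ℂ) / (D₀.c : ℂ) := by
    rw [hqdef]; push_cast; ring
  -- TOP: `qΛ_{W₀} ⊆ Λ_V` (always) and `q⁻¹Λ_V ⊆ Λ_{W₀}` (top), so `q = ±1`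
  have hcl1 : ∀ y ∈ D₀.L.lattice, ((q : ℚ) : ℂ) * y ∈ LV.lattice := by
    intro y hy
    obtain ⟨w', hw', rfl⟩ := hopt₀ y hy
    rw [← hfeq] at hw'
    have h1 : (D.c : ℂ) * (G * w') ∈ D.L.lattice := D.smul_periodLattice_le _ (hStevens w' hw')
    rw [htw, hqℂ]
    convert h1 using 1
    field_simp
  have hcl1' : ∀ z ∈ LV.lattice, (((q⁻¹ : ℚ) : ℚ) : ℂ) * z ∈ D₀.L.lattice := by
    intro y hy
    have h1 := (htw y).mp hy
    obtain ⟨z, hz, hz'⟩ := hopt _ h1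
    obtain ⟨w', hw', hw''⟩ := htop z hz
    have h2 : (D₀.c : ℂ) * w' ∈ D₀.L.lattice := D₀.smul_periodLattice_le _ (hfeq ▸ hw')
    have hy' : y = (((C.u : ℚ) : ℚ) : ℂ) * ((D.c : ℂ) * z) / G := by
      rw [← hz']
      field_simp
    have e : (((q⁻¹ : ℚ) : ℚ) : ℂ) * y = (D₀.c : ℂ) * w' := by
      rw [hy', Rat.cast_inv, hqℂ, hw'']
      field_simp
    rw [e]
    exact h2
  obtain ⟨k, hk⟩ := integral_neronScaling_of_isGloballyMinimal_holds W₀ V D₀.L LV D₀.isNeronLattice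
    hLV q hcl1
  obtain ⟨k', hk'⟩ := integral_neronScaling_of_isGloballyMinimal_holds V W₀ LV D₀.L hLV
    D₀.isNeronLattice q⁻¹ hcl1'
  have hkk : k * k' = 1 := by
    have h : (k : ℚ) * k' = 1 := by rw [hk, hk', mul_inv_cancel₀ hq0]
    exact_mod_cast h
  have hvq : padicValRat p q = 0 := by
    rcases Int.eq_one_or_neg_one_of_mul_eq_one hkk with h | h
    · rw [← hk, h]; simp
    · rw [← hk, h]; simp [padicValRat.neg]
  -- valuation count: `ord_p q = ord_p c + ord_p u − ord_p c₀ = 0`, `ord_p u = 0`, `p ∤ c₀`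
  have hval : padicValRat p (D.c : ℚ) = padicValRat p (D₀.c : ℚ) := by
    have e : padicValRat p q = padicValRat p (D.c : ℚ) + padicValRat p (C.u : ℚ) -
        padicValRat p (D₀.c : ℚ) := by
      rw [hqdef, padicValRat.div (mul_ne_zero (by exact_mod_cast hc) hu0) (by exact_mod_cast hc₀0),
        padicValRat.mul (by exact_mod_cast hc) hu0]
    rw [hvq, hu] at e
    linarith
  rw [padicValRat.of_int, padicValRat.of_int] at hval
  have h0 : padicValInt p D₀.c = 0 := padicValInt.eq_zero_of_not_dvd hc₀
  have hval' : padicValInt p D.c = padicValInt p D₀.c := by exact_mod_cast hval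
  have h0' : padicValInt p D.c = 0 := hval'.trans h0
  intro hdvd
  have h1 : 1 ≤ padicValInt p D.c := by
    have h := (padicValInt_dvd_iff 1 D.c).mp (by rwa [pow_one])
    exact h.resolve_left hc
  omega

/-- **The large-prime branch (`p ∈ {13, 163}` of R, or any row on which Edixhoven's two printed
forms and — at `p = 13` — the core apply).** For `W/ℚ` globally minimal, `D` a datum at a level `N`
that IS the conductor, `p > 7` prime with `p² ∣ N`, `W[p]` reducible and `D` lattice-optimal: `p ∤ c(D)`,
GRANTED modularity, Edixhoven Thm. 3 in both tree forms, and — used only when `p = 13` — C1, C2 and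
the rigidity THEOREM; at `p ≠ 13` the (G)-ordinary unstarred rows must be excluded by the caller (`hno`). Split:
`ord_p Δ_min > 4` ⟹ Kodaira symbol not II/III/IV (`kodairaSymbolAt_placeOf_II_or_III_or_IV_iff_of_addv`)
⟹ F.1; else not (G)-ordinary ⟹ F.2 (its hypothesis is `¬ TypeGOrd` verbatim); else `p = 13` and the
core. [cite: EdixhovenManin1991, Thm. 3] -/
theorem not_dvd_c_large_noDD (hnf : exists_isNewformOf)
    (hC1 : EisensteinOrdinaryTwistLatticeNotBottom) (hC2 : EisensteinOrdinaryStrongIsTop)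
    (hEdK : edixhoven_not_dvd_maninConstant_of_kodairaSymbol_ne)
    (hEdG : edixhoven_not_dvd_maninConstant_of_not_potentiallyGoodOrdinary)
    (W : WeierstrassCurve ℚ) [W.IsElliptic] [W.IsGloballyMinimal] (p : ℕ) [Fact p.Prime]
    [NeZero (W.conductorNorm ℤ)] (D : ModularParametrizationData W (W.conductorNorm ℤ))
    (hp7 : 7 < p) (hno : p ≠ 13 → ¬ (TypeGOrd W p ∧ padicValInt p W.minimalDiscriminantInt ≤ 4))
    (hsq : p ^ 2 ∣ W.conductorNorm ℤ) (hred : ¬ W.HasIrreducibleModPGaloisRep p)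
    (hopt : ∀ z ∈ D.L.lattice, ∃ w ∈ periodLattice D.f, z = D.c * w) :
    ¬ (p : ℤ) ∣ D.maninConstant := by
  have hpP : p.Prime := Fact.out
  have hp5 : 5 ≤ p := by omega
  have hadd : Rank1Residual.Addv W p := not_good_and_not_mult_of_sq_dvd_conductorNorm W hsq
  by_cases hlow : padicValInt p W.minimalDiscriminantInt ≤ 4
  · by_cases hGo : TypeGOrd W p
    · -- the core (only `p = 13` is live)
      have hp13 : p = 13 := by
        by_contra h
        exact hno h ⟨hGo, hlow⟩
      exact not_dvd_c_of_notBottom_of_strongIsTop_noDD hnf hC1 hC2 hEdK W p D hsq hp13 hred hGo hlow hopt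
    · -- not (G)-ordinary: Edixhoven Thm. 3, ordinarity form
      exact hEdG W D hopt p hpP hp7 hGo
  · -- starred: Edixhoven Thm. 3, Kodaira form
    have hnot : ¬ (W.kodairaSymbolAt (placeOf p) = .II ∨ W.kodairaSymbolAt (placeOf p) = .III ∨
        W.kodairaSymbolAt (placeOf p) = .IV) :=
      fun h ↦ hlow ((kodairaSymbolAt_placeOf_II_or_III_or_IV_iff_of_addv W p hp5 hadd).mp h)
    exact hEdK W D hopt p hpP hp7 (fun h ↦ hnot (Or.inl h)) (fun h ↦ hnot (Or.inr (Or.inl h)))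
      (fun h ↦ hnot (Or.inr (Or.inr h)))

end Summit.BirchSwinnertonDyer.BirchSwinnertonDyer.Theorems.TwistFamilyManinDescent.EisensteinTrichotomy

namespace Summit.BirchSwinnertonDyer.BirchSwinnertonDyer.Theorems

open WeierstrassCurve IsDedekindDomain NumberField Literature.NumberTheory.EllipticCurves
  Literature.NumberTheory.EllipticCurves.ModularForms Literature.NumberTheory.EllipticCurves.Rank1Residual
  Summit.BirchSwinnertonDyer.Rank1Residual.ManinAdditive Summit.BirchSwinnertonDyer.Rank1Residual.Additive
  Summit.BirchSwinnertonDyer.BirchSwinnertonDyer.Theses.TwistFamilyManinDescent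

/-! ### §2 The single-book ledger of C5 with FOUR prints (adapted verbatim from the lead's p637045) -/

/-- **The `W[p]`-reducible twist-minimal residual of C5 (hypothesis `hRED` of p611587, VERBATIM) ⟸ THREE prints {EdK, EdG, MazurJ} ∧ K15a (27072) ∧ K15b
(27071) ∧ `OrdinaryCornerManinResidual` (27552) ∧ C1 (25939) ∧ C2 (26929)** — NO ČNS, NO Cremona table: `p ∈ {5, 7}` by the row dispatch of
route `TwistFamilyManinDescent`'s residual (Ray57 ⟸ K15a ∧ K15b; Corner57 ⟸ T17 ∧ 27552 ∧ K15a ∧ Ray57; `W ⊗ p*` additive from odd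
twist-minimality), `p > 7` by pub/bsd-wall's `not_dvd_c_large` with Mazur's `j`-list excluding the (G)-ordinary unstarred rows off `13`.
Conditional result on OPEN items and cite-only prints; Dokchitser–Dokchitser 2015 is NO LONGER among them (the `13`-core runs on the
rigidity THEOREM `padicValInt_minimalDiscriminantInt_eq_of_isIsogenous_of_typeGOrd`). Adapted verbatim from the lead's
`reducibleTwistMinimal_of_fourPrints_of_items` (p637045) minus `hDD`. [cite: EdixhovenManin1991, Thm. 3 and §4] [cite: Mazur1978, Thm. 1]
[cite: DokchitserDokchitser2015LocalInvariants, Thm. 5.1 (1)] -/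
theorem reducibleTwistMinimal_of_threePrints_of_items
    (hEdK : edixhoven_not_dvd_maninConstant_of_kodairaSymbol_ne)
    (hEdG : edixhoven_not_dvd_maninConstant_of_not_potentiallyGoodOrdinary)
    (hJ : mazur_j_mem_of_not_hasIrreducibleModPGaloisRep_of_eleven_le)
    (hK15a : SupersingularStrongIsUnstarred) (hK15b : SupersingularUnstarredStrongManinUnit)
    (hOrd : OrdinaryCornerManinResidual)
    (hC1 : EisensteinOrdinaryTwistLatticeNotBottom) (hC2 : EisensteinOrdinaryStrongIsTop) :
    mazur_not_dvd_maninConstant_of_odd → abbesUllmo_not_dvd_maninConstant_of_not_dvd_level →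
    cesnavicius_not_two_dvd_maninConstant_of_two_dvd_level → exists_isNewformOf →
    ∀ (W : WeierstrassCurve ℚ) [W.IsElliptic] [W.IsGloballyMinimal] [NeZero (W.conductorNorm ℤ)]
      (D : ModularParametrizationData W (W.conductorNorm ℤ)),
      IsLatticeOptimal D → ∀ p : ℕ, p.Prime → 5 ≤ p → p ^ 2 ∣ W.conductorNorm ℤ →
      ¬ (∃ (W' : WeierstrassCurve ℚ) (q : ℕ), W'.IsElliptic ∧ W'.IsGloballyMinimal ∧ q.Prime ∧
          q ≠ 2 ∧ q ^ 2 ∣ W.conductorNorm ℤ ∧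
          IsIsogenous W (W'.quadraticTwist (((-1 : ℤ) ^ (q / 2) * q : ℤ) : ℚ)) ∧
          ¬ q ^ 2 ∣ W'.conductorNorm ℤ) →
      ¬ (∃ (W' : WeierstrassCurve ℚ) (d : ℤ), W'.IsElliptic ∧ W'.IsGloballyMinimal ∧
          (d = -1 ∨ d = 2 ∨ d = -2) ∧ 2 ^ 2 ∣ W.conductorNorm ℤ ∧
          IsIsogenous W (W'.quadraticTwist (d : ℚ)) ∧ ¬ 2 ^ 2 ∣ W'.conductorNorm ℤ) →
      ¬ W.HasIrreducibleModPGaloisRep p →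
      ¬ (p : ℤ) ∣ D.maninConstant := by
  have hRay : EisensteinRaynaudRegimeManinUnit := TwistFamilyManinDescent.raynaudRegimeOfOrientation_proof hK15a hK15b
  have hCor : EisensteinCornerManinResidual :=
    TwistFamilyManinDescent.cornerResidualOfSupersingularTransport_proof supersingularCornerTwistTransport_proof
      hOrd hK15a hRay
  intro hM hAU hC hnf W _ _ _ D hD p hp h5 hpN hodd _hdy hred
  haveI hpF : Fact p.Prime := ⟨hp⟩
  have hp2 : p ≠ 2 := by omega
  by_cases h57 : p = 5 ∨ p = 7
  · -- `p ∈ {5, 7}`: `W ⊗ p*` is additive by odd twist-minimality; dispatch on the Raynaud rows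
    have htw := quadraticTwist_pStar_additive_of_twistMinimal W hp hp2 hpN hodd
    rcases h57 with rfl | rfl
    · by_cases h58 : padicValInt 5 W.minimalDiscriminantInt ∈ ({4, 8} : Finset ℕ)
      · exact hRay hM hAU hC hnf W D 5 hp (Or.inl ⟨rfl, h58⟩) hpN hred htw hD
      · refine hCor hM hAU hC hnf W D 5 hp (Or.inl rfl) ?_ hpN hred htw hD
        rintro (⟨-, h⟩ | ⟨h7, -⟩)
        · exact h58 h
        · norm_num at h7
    · by_cases h79 : padicValInt 7 W.minimalDiscriminantInt ∈ ({3, 9} : Finset ℕ)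
      · exact hRay hM hAU hC hnf W D 7 hp (Or.inr ⟨rfl, h79⟩) hpN hred htw hD
      · refine hCor hM hAU hC hnf W D 7 hp (Or.inr rfl) ?_ hpN hred htw hD
        rintro (⟨h5', -⟩ | ⟨-, h⟩)
        · norm_num at h5'
        · exact h79 h
  · -- `p > 7`: Edixhoven's two forms off the (G)-ordinary unstarred rows, which Mazur's `j`-list empties off `13`; the core at `13`
    obtain ⟨hne5, hne7⟩ := not_or.mp h57
    have hp6 : p ≠ 6 := by rintro rfl; norm_num at hp
    have hp8 : p ≠ 8 := by rintro rfl; norm_num at hp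
    have hp9 : p ≠ 9 := by rintro rfl; norm_num at hp
    have hp10 : p ≠ 10 := by rintro rfl; norm_num at hp
    have h7 : 7 < p := by omega
    have h11 : 11 ≤ p := by omega
    have hadd : Addv W p := not_good_and_not_mult_of_sq_dvd_conductorNorm W hpN
    refine TwistFamilyManinDescent.EisensteinTrichotomy.not_dvd_c_large_noDD hnf hC1 hC2 hEdK hEdG W p D h7 ?_
      hpN hred hD
    intro hp13 hGv
    obtain ⟨hG, hv4⟩ := hGv
    by_cases hp37 : p = 37
    · subst hp37
      have h4 := four_lt_padicValInt_of_not_hasIrreducibleModPGaloisRep_thirtySeven W hJ hadd hred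
      omega
    · exact not_typeGOrd_of_not_hasIrreducibleModPGaloisRep_of_eleven_le W p hJ h11 hp13 hp37 hadd hred hG

/-- **Crux C5 `ManinLocalTwoThree.ManinPrimeToAdditiveFiveLe` BY NAME ⟸ FOUR cite-only prints {Kato F″, EdK, EdG, MazurJ} ∧ K15a (27072) ∧
K15b (27071) ∧ `OrdinaryCornerManinResidual` (27552) ∧ C1 (25939) ∧ C2 (26929)** — the width seat's Kato reduction p611587 fed with the
`W[p]`-irreducible locus from modularity ∧ F″ alone (`coreKP_of_kato`, pub/bsd-wall's `TeichmullerTwistDescent.not_dvd_c_of_kato`) and the reducible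
residual of `reducibleTwistMinimal_of_threePrints_of_items`. ČNS Thm. 1.2, Cremona's table and Dokchitser–Dokchitser 2015 are NOT used. Conditional result (`--supports`, helper).
[cite: Kato2004Asterisque, (8.1.3) and Thm. 9.7] [cite: EdixhovenManin1991, Thm. 3] [cite: Mazur1978, Thm. 1]
[cite: DokchitserDokchitser2015LocalInvariants, Thm. 5.1 (1)] -/
theorem maninPrimeToAdditiveFiveLe_of_fourPrints_of_items
    (hK57 : kato_neron_isIntegral_twistedSymbolSum_of_additive_five_le)
    (hEdK : edixhoven_not_dvd_maninConstant_of_kodairaSymbol_ne)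
    (hEdG : edixhoven_not_dvd_maninConstant_of_not_potentiallyGoodOrdinary)
    (hJ : mazur_j_mem_of_not_hasIrreducibleModPGaloisRep_of_eleven_le)
    (hK15a : SupersingularStrongIsUnstarred) (hK15b : SupersingularUnstarredStrongManinUnit)
    (hOrd : OrdinaryCornerManinResidual)
    (hC1 : EisensteinOrdinaryTwistLatticeNotBottom) (hC2 : EisensteinOrdinaryStrongIsTop) :
    Summit.BirchSwinnertonDyer.BirchSwinnertonDyer.Theses.ManinLocalTwoThree.ManinPrimeToAdditiveFiveLe := by
  intro hM hAU hC hnf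
  exact maninLocalTwoThree_maninPrimeToAdditiveFiveLe_of_kato57_of_cores hK57 (coreKP_of_kato hnf hK57)
    (reducibleTwistMinimal_of_threePrints_of_items hEdK hEdG hJ hK15a hK15b hOrd hC1 hC2) hM hAU hC hnf

/-- **C5 BY NAME ⟸ FOUR prints {F″, EdK, EdG, MazurJ} ∧ THE SEVEN LEAVES** — the single-book ledger of skeleton v15 with its
5th print (Dokchitser–Dokchitser 2015 Thm. 5.1 (1)) DISCHARGED: {K15a 27072, K15b 27071, I9 27660, K18a″ 27661, K18b″ 27662, C1 25939, C2 26929}: the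
previous theorem with stmt-27552 assembled from its LINE-18R leaves (`TwistFamilyManinDescent.ordinaryCornerOfSerreTateDepth_proof`, glue
stmt-27664, fed with `ordinaryCornerOffTable_proof`, stmt-27663). Conditional result (`--supports`, helper). [cite: EdixhovenManin1991, Thm. 3 and §4] -/
theorem maninPrimeToAdditiveFiveLe_of_fourPrints_of_sevenLeaves
    (hK57 : kato_neron_isIntegral_twistedSymbolSum_of_additive_five_le)
    (hEdK : edixhoven_not_dvd_maninConstant_of_kodairaSymbol_ne)
    (hEdG : edixhoven_not_dvd_maninConstant_of_not_potentiallyGoodOrdinary)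
    (hJ : mazur_j_mem_of_not_hasIrreducibleModPGaloisRep_of_eleven_le)
    (hK15a : SupersingularStrongIsUnstarred) (hK15b : SupersingularUnstarredStrongManinUnit)
    (hI9 : OrdinaryCornerOptimalSerreTateDeep) (hKa : OrdinaryCornerDeepEdixhovenDichotomy)
    (hKb : OrdinaryCornerDeepUnstarredNotBottom)
    (hC1 : EisensteinOrdinaryTwistLatticeNotBottom) (hC2 : EisensteinOrdinaryStrongIsTop) :
    Summit.BirchSwinnertonDyer.BirchSwinnertonDyer.Theses.ManinLocalTwoThree.ManinPrimeToAdditiveFiveLe :=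
  maninPrimeToAdditiveFiveLe_of_fourPrints_of_items hK57 hEdK hEdG hJ hK15a hK15b
    (TwistFamilyManinDescent.ordinaryCornerOfSerreTateDepth_proof hI9 hKa hKb ordinaryCornerOffTable_proof) hC1 hC2

end Summit.BirchSwinnertonDyer.BirchSwinnertonDyer.Theorems

end
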